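import Literature.NumberTheory.GaloisRepresentations.HomDualCupConnecting
import Literature.NumberTheory.GaloisRepresentations.HomDualCovariantSequence
import HarnessLib

/-!
# The Ш²-cochain bridge, global half: the idèle `2`-cochain `B = ξ̃ ∪ γ̃ + h̃ ∘ dγ̃` has `dB = F ∪ γ`, so `Z = B − H` is an
# idèle `2`-COCYCLE whose idèle-CLASS image is `h ∘ dγ̃` (pointwise cochain identities; step S2a of SHA2-BRIDGE-w3g7)

Route `SemiOrdinaryEisensteinDescent` (BSD, rung W-ALL row 2·3@3), Kolyvagin column, Cassels–Tate lane: print item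
`CasselsTateLevelInputsFact` (stmt-BirchSwinnertonDyer-20191).  Its one remaining input for THE canonical invariant maps is
`hPTc` (Milne I Thm. 4.10 (a) for `Ш²(K, E[q])` in `PTChoice` cochain form; p628097).  The bridge from cell bsd-schneider's
obstruction map `Ψ = H²(e⁻¹) ∘ δ₁^{Hom(S, K̄ˣ)} ∘ δ₀^{Hom(N₁, T)}` (`HomDual.shaTwoConnecting`) to that cochain form is the memo
`Cruxes/WildKolyvaginUpperAtThree/SHA2-BRIDGE-w3g7.md` (w3 g7); this file is its step S2a, the GLOBAL cochain identities, written
for ARBITRARY discrete Galois modules so that they instantiate verbatim on the canonical presentation `0 → N₁ → P → A → 0`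
(`X → Y → Z` here) and the idèle class sequence `0 → K̄ˣ → J̄ → C̄ → 0` (`U → J → C` here).  Width seat `bsd-wall-soed-p2-w3` g7;
`--supports stmt-BirchSwinnertonDyer-20480`, helper.  Route-free.

THE MATHEMATICS (memo §1 (iii)–(iv); conventions of the tree: `(dα)(σ,τ) = σα(τ) − α(στ) + α(σ)`,
`(db)(σ,τ,υ) = σb(τ,υ) − b(στ,υ) + b(σ,τυ) − b(σ,τ)` = `dTwo`, `(F ∪ γ)(σ,τ,υ) = F(σ,τ)(στ γ(υ))` = `cupCocycle₂₁` of the evaluation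
pairing).  Data: a ℤ-linear `h̃ : X → J` (lift of an equivariant `h : X → C`); the `Hom(X, U)`-valued `1`-cochain `ξ` with
`uJ ∘ ξ(σ) = σ⋆h̃ − h̃` (the `δ₀`-cocycle of `h̃`, `IsSES.f_δ₀Cocycle_apply`); a lift `ξ̃` of `ξ` to `Hom(Y, U)` (`ξ̃(σ) ∘ i = ξ(σ)`);
the `Hom(Z, U)`-valued `2`-cochain `F` with `F(σ,τ) ∘ p = σ⋆ξ̃(τ) − ξ̃(στ) + ξ̃(σ)` (the connecting cocycle,
`IsSES.f_connectingCocycle_apply`; its class is `Ψ h` up to `H²(e⁻¹)`); a `1`-cocycle `γ` of `Z` with a continuous lift `γ̃` to `Y`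
and the `X`-valued `2`-cocycle `c` with `i ∘ c = dγ̃` (again `f_connectingCocycle_apply`).  Then for the `J`-valued `2`-cochain

  `B(σ,τ) := uJ (ξ̃(σ)(σ γ̃(τ))) + h̃(c(σ,τ))`

* **`dTwo_bridgeCochain`** — `(dB)(σ,τ,υ) = uJ (F(σ,τ)(στ γ(υ)))` (= `uJ ∘ (F ∪ γ)`): Leibniz for the twisted cup `ξ̃ ∪ γ̃`
  (`d(ξ̃ ∪ γ̃) = dξ̃ ∪ γ̃ − ξ̃ ∪ dγ̃`, and `dξ̃ ∪ γ̃ = F ∪ γ`, `ξ̃ ∪ dγ̃ = ξ ∪ c`) plus `d(h̃ ∘ c) = (σ⋆h̃ − h̃) ∪ c = uJ (ξ ∪ c)`;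
* **`bridgeCocycle_mem`** — hence for a `U`-valued `H` with `dH = F ∪ γ` (it exists: `H³(K, μ_n) = 0`, `p` odd — not used here)
  the cochain `Z := B − uJ ∘ H` is a `2`-COCYCLE of `J`;
* **`idele_class_of_bridgeCocycle`** — and `jC ∘ Z = jC ∘ h̃ ∘ c` pointwise when `jC ∘ uJ = 0`: the idèle-class image of `Z` is the
  cocycle `h ∘ c` representing `h_*(δ₁ [γ])`.

THEOREMS ONLY (pointwise identities; no definition, no named fact, no instance, no `sorry`); nothing here is arithmetic — no case of
BSD, Poitou–Tate or Cassels–Tate is proved; the number field enters only in the later steps (S2b: the local half; S3: invariants).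

## References
* [MilneADT2006] J. S. Milne, *Arithmetic Duality Theorems*, 2nd ed. (2006), I §0 (pairings, (0.8)), I Thm. 4.10 (a) and its proof
  (p. 58), Lemma 4.13.
* [NeukirchSchmidtWingberg2008] J. Neukirch, A. Schmidt, K. Wingberg, *Cohomology of Number Fields* (2008), (1.3.2) (connecting maps
  on cochains), Prop. 1.4.1 and (1.4.3)–(1.4.4) (`∂(a ∪ b) = ∂a ∪ b + (−1)^p a ∪ ∂b`).
* [Harari2020] D. Harari, *Galois Cohomology and Class Field Theory* (2020), Prop. 16.17 (cup product vs. `Ext` pairing), Thm. 17.13.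
-/

noncomputable section

-- `Summit.<P>.<Sub>` repeats `BirchSwinnertonDyer` by the tree's layout convention (D-0017)
set_option linter.dupNamespace false
set_option autoImplicit false

namespace Summit.BirchSwinnertonDyer.BirchSwinnertonDyer.Theorems.ShaTwoCochain

open Literature.NumberTheory.GaloisRepresentations Literature.NumberTheory.GaloisRepresentations.HomDual
open Literature.Algebra.Homology Literature.Algebra.Homology.DiscreteRep ContRepresentation Field
open scoped ContRepresentation

variable {K : Type} [Field K]
variable {X Y Z U J C : Type}
  [AddCommGroup X] [TopologicalSpace X] [DiscreteTopology X] [Module.Finite ℤ X]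
  [AddCommGroup Y] [TopologicalSpace Y] [DiscreteTopology Y] [Module.Finite ℤ Y]
  [AddCommGroup Z] [TopologicalSpace Z] [DiscreteTopology Z]
  [AddCommGroup U] [TopologicalSpace U] [DiscreteTopology U]
  [AddCommGroup J] [TopologicalSpace J] [DiscreteTopology J]
  [AddCommGroup C] [TopologicalSpace C] [DiscreteTopology C]
variable {ρX : DiscreteGaloisModule K X} {ρY : DiscreteGaloisModule K Y} {ρZ : DiscreteGaloisModule K Z}
  {ρU : DiscreteGaloisModule K U} {ρJ : DiscreteGaloisModule K J} {ρC : DiscreteGaloisModule K C}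

/-! ## §1 Two pointwise equivariance lemmas -/

omit [TopologicalSpace X] [DiscreteTopology X] [Module.Finite ℤ X] in
/-- An intertwining map commutes with the actions, pointwise: `u (σ x) = σ (u x)`. [folklore] -/
theorem intertwining_apply_smul {M N : Type} [AddCommGroup M] [TopologicalSpace M] [DiscreteTopology M]
    [AddCommGroup N] [TopologicalSpace N] [DiscreteTopology N]
    {ρ : DiscreteGaloisModule K M} {ρ' : DiscreteGaloisModule K N}
    (u : ρ.toContRepresentation →ⁱL ρ'.toContRepresentation) (σ : absoluteGaloisGroup K) (x : M) :
    u (ρ σ x) = ρ' σ (u x) :=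
  congr($(u.isIntertwining' σ) x)

omit [Module.Finite ℤ Y] [TopologicalSpace U] [DiscreteTopology U] in
/-- The `Hom`-module action evaluated on a translated vector: `(σ⋆Φ)(σ y) = σ (Φ y)`. [cite: MilneADT2006, I §0] -/
theorem homGaloisModule_apply_smul [Module.Finite ℤ Y] [TopologicalSpace U] [DiscreteTopology U]
    (ρY : DiscreteGaloisModule K Y) (ρU : DiscreteGaloisModule K U)
    (σ : absoluteGaloisGroup K) (Φ : DiscreteRep.HomCarrier Y U) (y : Y) :
    (show Y →ₗ[ℤ] U from homGaloisModule ρY ρU σ Φ) (ρY σ y) = ρU σ ((show Y →ₗ[ℤ] U from Φ) y) := by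
  rw [homGaloisModule_apply]
  change ρU σ ((show Y →ₗ[ℤ] U from Φ) (ρY σ⁻¹ (ρY σ y))) = _
  rw [← Module.End.mul_apply, ← map_mul, inv_mul_cancel, map_one, Module.End.one_apply]

/-! ## §2 `dB = uJ ∘ (F ∪ γ)` -/

variable (i : ρX.toContRepresentation →ⁱL ρY.toContRepresentation)
  (p : ρY.toContRepresentation →ⁱL ρZ.toContRepresentation)
  (uJ : ρU.toContRepresentation →ⁱL ρJ.toContRepresentation)

/-- **`dB = uJ ∘ (F ∪ γ)` pointwise** for the bridge cochain `B(σ,τ) = uJ (ξ̃(σ)(σ γ̃(τ))) + h̃(c(σ,τ))` — see the module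
docstring for the data `h̃, ξ, ξ̃, F, γ, γ̃, c` and their defining identities, all displayed as hypotheses on VALUES (so that the
lemma instantiates on `IsSES.δ₀Cocycle`, `IsSES.liftCocycle`, `IsSES.connectingCocycle` of any short exact sequences).
[cite: NeukirchSchmidtWingberg2008, Prop. 1.4.1, (1.3.2)][cite: MilneADT2006, I Thm. 4.10 (a) (proof, p. 58)] -/
theorem dTwo_bridgeCochain
    (ht : DiscreteRep.HomCarrier X J)
    (ξ : C(absoluteGaloisGroup K, DiscreteRep.HomCarrier X U))
    (hξ : ∀ (σ : absoluteGaloisGroup K) (x : X),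
      uJ ((show X →ₗ[ℤ] U from ξ σ) x) = (show X →ₗ[ℤ] J from homGaloisModule ρX ρJ σ ht) x - (show X →ₗ[ℤ] J from ht) x)
    (ξt : C(absoluteGaloisGroup K, DiscreteRep.HomCarrier Y U))
    (hξt : ∀ (σ : absoluteGaloisGroup K) (x : X), (show Y →ₗ[ℤ] U from ξt σ) (i x) = (show X →ₗ[ℤ] U from ξ σ) x)
    (F : C(absoluteGaloisGroup K × absoluteGaloisGroup K, DiscreteRep.HomCarrier Z U))
    (hF : ∀ (σ τ : absoluteGaloisGroup K) (y : Y), (show Z →ₗ[ℤ] U from F (σ, τ)) (p y) =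
      (show Y →ₗ[ℤ] U from homGaloisModule ρY ρU σ (ξt τ)) y - (show Y →ₗ[ℤ] U from ξt (σ * τ)) y +
        (show Y →ₗ[ℤ] U from ξt σ) y)
    (γ : contOneCocycles ρZ.toTopRep) (γt : C(absoluteGaloisGroup K, Y)) (hγt : ∀ σ, p (γt σ) = γ.1 σ)
    (c : C(absoluteGaloisGroup K × absoluteGaloisGroup K, X))
    (hc : ∀ σ τ : absoluteGaloisGroup K, i (c (σ, τ)) = ρY σ (γt τ) - γt (σ * τ) + γt σ)
    (hcc : ∀ σ τ υ : absoluteGaloisGroup K, ρX σ (c (τ, υ)) + c (σ, τ * υ) = c (σ * τ, υ) + c (σ, τ))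
    (B : C(absoluteGaloisGroup K × absoluteGaloisGroup K, J))
    (hB : ∀ σ τ : absoluteGaloisGroup K,
      B (σ, τ) = uJ ((show Y →ₗ[ℤ] U from ξt σ) (ρY σ (γt τ))) + (show X →ₗ[ℤ] J from ht) (c (σ, τ)))
    (σ τ υ : absoluteGaloisGroup K) :
    dTwo ρJ.toTopRep B σ τ υ = uJ ((show Z →ₗ[ℤ] U from F (σ, τ)) (ρZ (σ * τ) (γ.1 υ))) := by
  -- abbreviations for the two recurring vectors
  set w : X := ρX σ (c (τ, υ)) with hw
  set y : Y := ρY (σ * τ) (γt υ) with hy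
  -- (1) the action of `σ` on `B(τ, υ)`
  have h1 : ρJ.toTopRep.ρ σ (B (τ, υ)) =
      uJ ((show Y →ₗ[ℤ] U from homGaloisModule ρY ρU σ (ξt τ)) y) +
        (show X →ₗ[ℤ] J from homGaloisModule ρX ρJ σ ht) w := by
    rw [ContinuousRep.toTopRep_ρ_apply, hB, map_add, ← intertwining_apply_smul uJ σ, ← homGaloisModule_apply_smul ρY ρU σ,
      ← homGaloisModule_apply_smul ρX ρJ σ, ← Module.End.mul_apply, ← map_mul, ← hy, ← hw]
  -- (2) the `c`-terms: `h̃ c(στ,υ) − h̃ c(σ,τυ) + h̃ c(σ,τ) = h̃ (σ c(τ,υ))`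
  have h2 : (show X →ₗ[ℤ] J from ht) (c (σ * τ, υ)) - (show X →ₗ[ℤ] J from ht) (c (σ, τ * υ)) +
      (show X →ₗ[ℤ] J from ht) (c (σ, τ)) = (show X →ₗ[ℤ] J from ht) w := by
    rw [← map_sub, ← map_add, hw]
    congr 1
    have h' := hcc σ τ υ
    calc c (σ * τ, υ) - c (σ, τ * υ) + c (σ, τ) = (c (σ * τ, υ) + c (σ, τ)) - c (σ, τ * υ) := by abel
      _ = (ρX σ (c (τ, υ)) + c (σ, τ * υ)) - c (σ, τ * υ) := by rw [h']
      _ = ρX σ (c (τ, υ)) := by abel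
  -- (3) `σ γ̃(τυ) − σ γ̃(τ) − στ γ̃(υ) = − i (σ c(τ,υ))`
  have h3 : ρY σ (γt (τ * υ)) - ρY σ (γt τ) - y = - i w := by
    rw [hw, intertwining_apply_smul i σ, hc, hy, map_mul ρY σ τ, Module.End.mul_apply]
    simp only [map_add, map_sub]
    abel
  -- (4) the `ξ̃`-terms against `y`: `(σ⋆ξ̃τ − ξ̃(στ) + ξ̃σ) y = F(σ,τ) (p y) = F(σ,τ)(στ γ υ)`
  have h4 : (show Y →ₗ[ℤ] U from homGaloisModule ρY ρU σ (ξt τ)) y - (show Y →ₗ[ℤ] U from ξt (σ * τ)) y +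
      (show Y →ₗ[ℤ] U from ξt σ) y = (show Z →ₗ[ℤ] U from F (σ, τ)) (ρZ (σ * τ) (γ.1 υ)) := by
    rw [← hF, hy, intertwining_apply_smul p (σ * τ), hγt]
  -- (5) `ξ̃σ (−i w) = −ξσ w`, and `uJ (ξσ w) = (σ⋆h̃) w − h̃ w`
  have h5 : uJ ((show Y →ₗ[ℤ] U from ξt σ) (ρY σ (γt (τ * υ)) - ρY σ (γt τ) - y)) =
      -((show X →ₗ[ℤ] J from homGaloisModule ρX ρJ σ ht) w - (show X →ₗ[ℤ] J from ht) w) := by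
    rw [h3, map_neg, map_neg, hξt, hξ]
  -- assemble
  rw [dTwo_apply, h1, hB, hB, hB, ← hy]
  have e1 : uJ ((show Y →ₗ[ℤ] U from ξt σ) (ρY σ (γt (τ * υ)))) - uJ ((show Y →ₗ[ℤ] U from ξt σ) (ρY σ (γt τ))) -
      uJ ((show Y →ₗ[ℤ] U from ξt σ) y) =
      -((show X →ₗ[ℤ] J from homGaloisModule ρX ρJ σ ht) w - (show X →ₗ[ℤ] J from ht) w) := by
    rw [← h5, map_sub, map_sub, map_sub, map_sub]
  have e2 : uJ ((show Y →ₗ[ℤ] U from homGaloisModule ρY ρU σ (ξt τ)) y) - uJ ((show Y →ₗ[ℤ] U from ξt (σ * τ)) y) +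
      uJ ((show Y →ₗ[ℤ] U from ξt σ) y) = uJ ((show Z →ₗ[ℤ] U from F (σ, τ)) (ρZ (σ * τ) (γ.1 υ))) := by
    rw [← h4, map_add, map_sub]
  rw [← e2]
  have e3 := h2
  -- goal: σB(τ,υ)-expansion − B(στ,υ) + B(σ,τυ) − B(σ,τ) = e2's left side
  have e4 : (show X →ₗ[ℤ] J from homGaloisModule ρX ρJ σ ht) w =
      (show X →ₗ[ℤ] J from ht) w - (uJ ((show Y →ₗ[ℤ] U from ξt σ) (ρY σ (γt (τ * υ)))) -
        uJ ((show Y →ₗ[ℤ] U from ξt σ) (ρY σ (γt τ))) - uJ ((show Y →ₗ[ℤ] U from ξt σ) y)) := by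
    rw [e1]; abel
  rw [e4, ← e3]
  abel

/-! ## §3 `Z = B − uJ ∘ H` is a `2`-cocycle with idèle-class image `h ∘ c` -/

/-- **The bridge cocycle**: if moreover `dH = F ∪ γ` pointwise for a `U`-valued `2`-cochain `H`, then any `J`-valued `Z` with
`Z(σ,τ) = B(σ,τ) − uJ (H(σ,τ))` is a continuous `2`-COCYCLE of `J`. [cite: MilneADT2006, I Thm. 4.10 (a) (proof, p. 58)]
[cite: NeukirchSchmidtWingberg2008, (1.3.2), Prop. 1.4.1] -/
theorem bridgeCocycle_mem
    (ht : DiscreteRep.HomCarrier X J)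
    (ξ : C(absoluteGaloisGroup K, DiscreteRep.HomCarrier X U))
    (hξ : ∀ (σ : absoluteGaloisGroup K) (x : X),
      uJ ((show X →ₗ[ℤ] U from ξ σ) x) = (show X →ₗ[ℤ] J from homGaloisModule ρX ρJ σ ht) x - (show X →ₗ[ℤ] J from ht) x)
    (ξt : C(absoluteGaloisGroup K, DiscreteRep.HomCarrier Y U))
    (hξt : ∀ (σ : absoluteGaloisGroup K) (x : X), (show Y →ₗ[ℤ] U from ξt σ) (i x) = (show X →ₗ[ℤ] U from ξ σ) x)
    (F : C(absoluteGaloisGroup K × absoluteGaloisGroup K, DiscreteRep.HomCarrier Z U))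
    (hF : ∀ (σ τ : absoluteGaloisGroup K) (y : Y), (show Z →ₗ[ℤ] U from F (σ, τ)) (p y) =
      (show Y →ₗ[ℤ] U from homGaloisModule ρY ρU σ (ξt τ)) y - (show Y →ₗ[ℤ] U from ξt (σ * τ)) y +
        (show Y →ₗ[ℤ] U from ξt σ) y)
    (γ : contOneCocycles ρZ.toTopRep) (γt : C(absoluteGaloisGroup K, Y)) (hγt : ∀ σ, p (γt σ) = γ.1 σ)
    (c : C(absoluteGaloisGroup K × absoluteGaloisGroup K, X))
    (hc : ∀ σ τ : absoluteGaloisGroup K, i (c (σ, τ)) = ρY σ (γt τ) - γt (σ * τ) + γt σ)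
    (hcc : ∀ σ τ υ : absoluteGaloisGroup K, ρX σ (c (τ, υ)) + c (σ, τ * υ) = c (σ * τ, υ) + c (σ, τ))
    (B : C(absoluteGaloisGroup K × absoluteGaloisGroup K, J))
    (hB : ∀ σ τ : absoluteGaloisGroup K,
      B (σ, τ) = uJ ((show Y →ₗ[ℤ] U from ξt σ) (ρY σ (γt τ))) + (show X →ₗ[ℤ] J from ht) (c (σ, τ)))
    (H : C(absoluteGaloisGroup K × absoluteGaloisGroup K, U))
    (hH : ∀ σ τ υ : absoluteGaloisGroup K,
      (show Z →ₗ[ℤ] U from F (σ, τ)) (ρZ (σ * τ) (γ.1 υ)) = dTwo ρU.toTopRep H σ τ υ)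
    (Zc : C(absoluteGaloisGroup K × absoluteGaloisGroup K, J))
    (hZ : ∀ σ τ : absoluteGaloisGroup K, Zc (σ, τ) = B (σ, τ) - uJ (H (σ, τ))) :
    Zc ∈ contTwoCocycles ρJ.toTopRep := by
  rw [mem_contTwoCocycles_iff_dTwo]
  intro σ τ υ
  have hd : dTwo ρJ.toTopRep Zc σ τ υ = dTwo ρJ.toTopRep B σ τ υ - uJ (dTwo ρU.toTopRep H σ τ υ) := by
    simp only [dTwo_apply, hZ, map_sub, map_add, ContinuousRep.toContRepresentation_apply_apply,
      intertwining_apply_smul uJ σ]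
    abel
  rw [hd, dTwo_bridgeCochain i p uJ ht ξ hξ ξt hξt F hF γ γt hγt c hc hcc B hB, hH, sub_self]

variable (jC : ρJ.toContRepresentation →ⁱL ρC.toContRepresentation)

omit [DiscreteTopology X] [Module.Finite ℤ X] [Module.Finite ℤ Y] in
/-- **The idèle-CLASS image of the bridge cocycle is `h ∘ c`**: if `jC ∘ uJ = 0` (the composite `K̄ˣ → J̄ → C̄`), then
`jC (Z(σ,τ)) = jC (h̃ (c(σ,τ))) = h (c(σ,τ))` for `h = jC ∘ h̃` — the cocycle `h ∘ c` represents `h_*(δ₁ [γ])`.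
[cite: MilneADT2006, I Thm. 4.10 (a) (proof, p. 58)] -/
theorem idele_class_of_bridgeCocycle
    (hjU : ∀ u : U, jC (uJ u) = 0)
    (ht : DiscreteRep.HomCarrier X J) (ξt : C(absoluteGaloisGroup K, DiscreteRep.HomCarrier Y U))
    (γt : C(absoluteGaloisGroup K, Y)) (c : C(absoluteGaloisGroup K × absoluteGaloisGroup K, X))
    (B : C(absoluteGaloisGroup K × absoluteGaloisGroup K, J))
    (hB : ∀ σ τ : absoluteGaloisGroup K,
      B (σ, τ) = uJ ((show Y →ₗ[ℤ] U from ξt σ) (ρY σ (γt τ))) + (show X →ₗ[ℤ] J from ht) (c (σ, τ)))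
    (H : C(absoluteGaloisGroup K × absoluteGaloisGroup K, U))
    (Zc : C(absoluteGaloisGroup K × absoluteGaloisGroup K, J))
    (hZ : ∀ σ τ : absoluteGaloisGroup K, Zc (σ, τ) = B (σ, τ) - uJ (H (σ, τ))) (σ τ : absoluteGaloisGroup K) :
    jC (Zc (σ, τ)) = jC ((show X →ₗ[ℤ] J from ht) (c (σ, τ))) := by
  rw [hZ, hB, map_sub, map_add, hjU, hjU, zero_add, sub_zero]

end Summit.BirchSwinnertonDyer.BirchSwinnertonDyer.Theorems.ShaTwoCochain

end
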